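import Summits.QuantumFields.BalabanUV.Beta.GAN24.CombContactCellBounds
import Summits.QuantumFields.BalabanUV.Beta.GAN24.ContactAssembly

/-!
# `BalabanUV.Beta.GAN24.CombContactAssembly` — binder row G-an2-4 ∕ (CONV-C), TRANSFER-III, the (III′) S-slot (b) of the END R `CombChargeRowsClosed` (the G-an2-4 END at
# row D1's literal of record displays EXACTLY (b) ∧ W-an2-1′; road-P2's M.104 `CombSRowsOfContactLetters` reads (b) from SIX contact letters): **THE FIRST OF THE SIX —
# THE (III′) WILSON CONTACT END `hCT′` IS A THEOREM, `k`-UNIFORMLY, FROM `2 ≤ Lc` ALONE**: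
# `|push₃ T′ T′ T′ (wilsonA 3) κ′ u′ x′ z′ (inl α) (inl β) − push₃ B B B (wilsonA 3) κ′ u′ x′ z′ (inl α) (inl β)| ≤ K·(Lc^{12(k+1)})⁻¹·e^{−κ′(‖x′−u′‖∞ + ‖z′−u′‖∞)}`,
# `T′ = legChain (j ↦ legComp ψ♭ (respStepBmSeq ρ Lc j)) 0 k` (the CONJUGATED dressed composite legs of the comb chart: every (E) dressed leg followed by the field block `ψ♭` of
# `Ψ̂_S = psiKS r Lc`), `B = respStep 1 (Lc^(k+1))`, for EVERY pair of in-block roots `r` (of `Ψ̂_S`), `rr` (of the dressing), EVERY `k` and every coarse data — §3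
# `exists_comb_contact_bound`; §4 `exists_comb_contact_bound_ctr` = the same at the centred roots `r = rr = ctrOff 4 Lc`, LITERALLY the hypothesis `hCT` of M.104
# `exists_hS_hSall_ScombOf_of_contactLetters` (roots `ctrOff (3+1) Lc` ∕ `ctr (3+1) Lc`).

NOT IN PRINT; OUR PROOF (G-an2-4 formalisation swarm, leaf prover `b2b-balaban-gan24-formalise-leaf-01`, gen 89; the (III′) twin of MY g58 (E) `ContactAssembly`: road-P2's M.59 cells
`contact_combLegChain_ff_eq_cells` ⨾ MY `CombContactCellBounds` (three cells, staircase length `k+1`) ⨾ MY (E) `exists_common_letters` BY NAME (one rate for (N1), I1, the tent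
bound; its dressed-envelope clause unused) ⨾ the two power identities of §2 (the (E) ones with `α₀ ↦ α₁`, `Lc^k ↦ Lc^{k+1}`: ONE extra power of `Lc` inside `K`, `k`-uniformity
untouched) ⨾ the (E) spread bookkeeping `exp_spread_rebase ∕ exp_spread_half` BY NAME.  [folklore]-grade bookkeeping ∕ real analysis on the cell's typed `U = 1` objects; 0 `def`,
0 cited facts, 0 `def … : Prop`, 0 sorry; constants existential (`κ′ = κ₀∕24`; `K` a displayed polynomial in `C, Φ₀, Lc, e^{κ₀}, Zl` and the root-free face letter
`F = Σ_{r′ ∈ box} faceWtSum r′ Lc`).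
HONEST FRAMING (cell contract, verbatim): «discharging `BetaPertH` makes Bałaban's UV stability UNCONDITIONAL — a real constructive-QFT result; it is NOT the continuum
limit and NOT the Clay problem.»  HONEST DEPENDENCY (verbatim): «continuum YM on T⁴ ⇐ BetaPertH ∧ nine spine estimates (0/9 proved); BetaPertH ⇐ (D1) ∧ (D4) ∧ CAP+tail;
G-an2-4 gates asym, D1 and NE2/3/4.»
WHAT THIS IS NOT: it discharges ONE of M.104's six hypotheses (the Wilson contact END `hCT`), NOT the Wilson rate END `hCTd`, NOT the born letters `hCg hPc hCv hPcV`, hence NOT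
(hS, hSall) of `ScombOf`, NOT (b); 0 wall binders; NEVER «G-an2-4 closed» as (CONV-C); NOT D1, NOT BetaPertH, NOT continuum, NOT Clay.  2026-08-28; no existing file touched.
-/

noncomputable section

open Finset
open scoped BigOperators
open Literature.MathematicalPhysics.QuantumFieldTheory
open Literature.MathematicalPhysics.QuantumFieldTheory.LatticeForm (quo)
open Literature.MathematicalPhysics.QuantumFieldTheory.Balaban1983to89
open Literature.MathematicalPhysics.QuantumFieldTheory.Balaban1983to89.Beta
open B4ContourShift (supNorm supNorm_nonneg abs_le_supNorm)
open ExpKernelCalculus (Zl Zl_nonneg)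
open StepJetData (wilsonA)
open AffineAveraging (Form0 Form1 Site box toSite curv curvAdj)
open AveragingContoursRooted (ctr ctrOff ctrOff_mem_box)
open AffineReproduction (contourSumAdj)
open KernelSpecInstance (wΦ)
open B6BondElimination (unitVec)
open KKTFluctuationKernel (delta1)
open BalabanCompositeJets (respStep)
open Summit.QuantumFields.BalabanUV.Beta.AxialProjectorBlockMean (bmGaugeAt)
open Summit.QuantumFields.BalabanUV.Beta.SymCorrectorKernel (psiKS)
open Summit.QuantumFields.BalabanUV.Beta.SymCorrectorFace (faceWtSum faceWtSum_nonneg)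
open Summit.QuantumFields.BalabanUV.Beta.GAN24.Push4 (legComp)
open Summit.QuantumFields.BalabanUV.Beta.GAN24.Push4Iter (LegFam legChain)
open Summit.QuantumFields.BalabanUV.Beta.GAN24.RespStepBmDecompExact (respStepBmSeq)
open Summit.QuantumFields.BalabanUV.Beta.GAN24.RespStepBmDecompPsi (Psi)
open Summit.QuantumFields.BalabanUV.Beta.GAN24.Push3 (push₃)
open Summit.QuantumFields.BalabanUV.Beta.GAN24.ContactPartnerLetters (respStep_pow_zero)
open Summit.QuantumFields.BalabanUV.Beta.GAN24.ContactAssembly (exists_common_letters exp_spread_rebase exp_spread_half)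
open Summit.QuantumFields.BalabanUV.Beta.GAN24.CombLegChainGauge (PsiFace)
open Summit.QuantumFields.BalabanUV.Beta.GAN24.CombContactKernelCells (contact_combLegChain_ff_eq_cells)
open Summit.QuantumFields.BalabanUV.Beta.GAN24.CombContactCellBounds (abs_cellL_bound abs_cellR_bound abs_cellW_bound)

namespace Summit.QuantumFields.BalabanUV.Beta.GAN24.CombContactAssembly

variable {Lc : ℕ} [NeZero Lc]

/-! ## §1 Bookkeeping: the two power identities of the (III′) cells (main order; ONE extra `Lc` against (E) inside the constants) -/

/-- [folklore] **THE THREE-ENVELOPE POWER IDENTITY** for the (III′) letters: with `N = Lc^(k+1)`, `α₁ = (8Lc + F·c₁)·C·N⁻⁵` (`c₁ = 1 + 8Lc(e^{κ₀}+1)`),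
`½·4·(2·α₁·N·e^{κ₀})·(C N⁻⁵·(N·Φ₀N⁻⁸·e^{κ₀}) + C N⁻⁵·(N·Φ₀N⁻⁸·e^{κ₀}))·N⁴ = (8·(8Lc + F·c₁)·C·C·Φ₀·e^{κ₀}·e^{κ₀})·(Lc^{12(k+1)})⁻¹`. -/
theorem coeff_env3_eq (C Φ₀ κ₀ F : ℝ) (k : ℕ) :
    (1 / 2 : ℝ) * ((((3 : ℕ) : ℝ) + 1) *
        ((2 * (8 * (Lc : ℝ) * C * ((Lc : ℝ) ^ (5 * (k + 1)))⁻¹ + F * ((1 + 8 * (Lc : ℝ) * (Real.exp κ₀ + 1)) * C * ((Lc : ℝ) ^ (5 * (k + 1)))⁻¹)) *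
            (Lc : ℝ) ^ (k + 1)) * Real.exp κ₀) *
          ((C * ((Lc : ℝ) ^ (5 * (k + 1)))⁻¹) * ((Lc ^ (k + 1) : ℕ) * (Φ₀ * ((Lc : ℝ) ^ (8 * (k + 1)))⁻¹) * Real.exp κ₀)
            + (C * ((Lc : ℝ) ^ (5 * (k + 1)))⁻¹) * ((Lc ^ (k + 1) : ℕ) * (Φ₀ * ((Lc : ℝ) ^ (8 * (k + 1)))⁻¹) * Real.exp κ₀))) *
        (((Lc ^ (k + 1) : ℕ) : ℝ)) ^ (3 + 1)
      = (8 * ((8 * (Lc : ℝ) + F * (1 + 8 * (Lc : ℝ) * (Real.exp κ₀ + 1))) * C) * C * Φ₀ * Real.exp κ₀ * Real.exp κ₀) * ((Lc : ℝ) ^ (12 * (k + 1)))⁻¹ := by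
  have hL0 : (Lc : ℝ) ≠ 0 := by exact_mod_cast NeZero.ne Lc
  have hx : (((Lc ^ (k + 1) : ℕ) : ℝ)) = (Lc : ℝ) ^ (k + 1) := by push_cast; ring
  have e5 : (Lc : ℝ) ^ (5 * (k + 1)) = ((Lc : ℝ) ^ (k + 1)) ^ 5 := by rw [← pow_mul']
  have e8 : (Lc : ℝ) ^ (8 * (k + 1)) = ((Lc : ℝ) ^ (k + 1)) ^ 8 := by rw [← pow_mul']
  have e12 : (Lc : ℝ) ^ (12 * (k + 1)) = ((Lc : ℝ) ^ (k + 1)) ^ 12 := by rw [← pow_mul']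
  have hy : (Lc : ℝ) ^ (k + 1) ≠ 0 := pow_ne_zero _ hL0
  rw [hx, e5, e8, e12]
  field_simp
  ring

/-- [folklore] **THE PAIRING POWER IDENTITY** for the (III′) letters (the scale sum's `Lc^{k+1}` IS `N`):
`½·4·(8e^{5κ₀}·α₁²·N·(2τ + Φ₀′N))·N⁴ = (16·e^{5κ₀}·((8Lc + F·c₁)·C)²·Φ₀·(2·e^{κ₀} + 1))·(Lc^{12(k+1)})⁻¹`. -/
theorem coeff_pair_eq (C Φ₀ κ₀ F : ℝ) (k : ℕ) :
    (1 / 2 : ℝ) * ((((3 : ℕ) : ℝ) + 1) *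
        ((8 * Real.exp (5 * κ₀) *
            (8 * (Lc : ℝ) * C * ((Lc : ℝ) ^ (5 * (k + 1)))⁻¹ + F * ((1 + 8 * (Lc : ℝ) * (Real.exp κ₀ + 1)) * C * ((Lc : ℝ) ^ (5 * (k + 1)))⁻¹)) *
            (8 * (Lc : ℝ) * C * ((Lc : ℝ) ^ (5 * (k + 1)))⁻¹ + F * ((1 + 8 * (Lc : ℝ) * (Real.exp κ₀ + 1)) * C * ((Lc : ℝ) ^ (5 * (k + 1)))⁻¹)) *
            (Lc : ℝ) ^ (k + 1) * (2 * ((Lc ^ (k + 1) : ℕ) * (Φ₀ * ((Lc : ℝ) ^ (8 * (k + 1)))⁻¹) * Real.exp κ₀)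
              + (Φ₀ * ((Lc : ℝ) ^ (8 * (k + 1)))⁻¹) * (Lc : ℝ) ^ (k + 1))) * (((Lc ^ (k + 1) : ℕ) : ℝ)) ^ (3 + 1)))
      = (16 * Real.exp (5 * κ₀) * ((8 * (Lc : ℝ) + F * (1 + 8 * (Lc : ℝ) * (Real.exp κ₀ + 1))) * C) ^ 2 * Φ₀ * (2 * Real.exp κ₀ + 1)) *
          ((Lc : ℝ) ^ (12 * (k + 1)))⁻¹ := by
  have hL0 : (Lc : ℝ) ≠ 0 := by exact_mod_cast NeZero.ne Lc
  have hx : (((Lc ^ (k + 1) : ℕ) : ℝ)) = (Lc : ℝ) ^ (k + 1) := by push_cast; ring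
  have e5 : (Lc : ℝ) ^ (5 * (k + 1)) = ((Lc : ℝ) ^ (k + 1)) ^ 5 := by rw [← pow_mul']
  have e8 : (Lc : ℝ) ^ (8 * (k + 1)) = ((Lc : ℝ) ^ (k + 1)) ^ 8 := by rw [← pow_mul']
  have e12 : (Lc : ℝ) ^ (12 * (k + 1)) = ((Lc : ℝ) ^ (k + 1)) ^ 12 := by rw [← pow_mul']
  have hy : (Lc : ℝ) ^ (k + 1) ≠ 0 := pow_ne_zero _ hL0
  rw [hx, e5, e8, e12]
  field_simp
  ring

/-! ## §2 THE (III′) END -/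

/-- NOT IN PRINT; OUR PROOF.  **THE (III′) WILSON CONTACT END — THE CONTACT TERM OF THE CONJUGATED CUBIC WILSON PUSH IS MAIN ORDER, `k`-UNIFORMLY, FOR EVERY PAIR OF IN-BLOCK
ROOTS** (`d = 3`): from `2 ≤ Lc` ALONE, `∃ κ′ > 0, K ≥ 0` such that for EVERY root offset `r ∈ box 4 Lc` of `Ψ̂_S`, EVERY dressing root `rr ∈ box 4 Lc`, EVERY number of levels
`k`, and every coarse data `κ′ u′ x′ z′ α β`,
`|push₃ T′ T′ T′ (wilsonA 3) κ′ u′ x′ z′ (inl α) (inl β) − push₃ B B B (wilsonA 3) κ′ u′ x′ z′ (inl α) (inl β)| ≤ K·(Lc^{12(k+1)})⁻¹·e^{−κ′(‖x′ − u′‖∞ + ‖z′ − u′‖∞)}`,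
`T′ = legChain (j ↦ legComp ψ♭ (respStepBmSeq (toSite rr) Lc j)) 0 k`, `ψ♭ α x κ u = psiKS r Lc u x (inl κ) (inl α)`, `B = respStep 1 (Lc^(k+1))`.  `κ′ = κ₀∕24`, `K` a displayed
polynomial in the letters with the root-free face letter `F = Σ_{r′ ∈ box} faceWtSum r′ Lc`. -/
theorem exists_comb_contact_bound (hLc : 2 ≤ Lc) :
    ∃ κ' K : ℝ, 0 < κ' ∧ 0 ≤ K ∧ ∀ (r : Fin (3 + 1) → ℕ), r ∈ box (3 + 1) Lc → ∀ (rr : Fin (3 + 1) → ℕ), rr ∈ box (3 + 1) Lc →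
      ∀ (k : ℕ) (κ₁ : Fin (3 + 1)) (u' x' z' : Site (3 + 1)) (α β : Fin (3 + 1)),
        |push₃ (legChain (fun j => legComp (fun α x κ u => psiKS r Lc u x (Sum.inl κ) (Sum.inl α)) (respStepBmSeq (d := 3) (toSite rr) Lc j)) 0 k)
            (legChain (fun j => legComp (fun α x κ u => psiKS r Lc u x (Sum.inl κ) (Sum.inl α)) (respStepBmSeq (d := 3) (toSite rr) Lc j)) 0 k)
            (legChain (fun j => legComp (fun α x κ u => psiKS r Lc u x (Sum.inl κ) (Sum.inl α)) (respStepBmSeq (d := 3) (toSite rr) Lc j)) 0 k)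
            (wilsonA 3) κ₁ u' x' z' (Sum.inl α) (Sum.inl β)
          - push₃ (respStep (d := 3) 1 (Lc ^ (k + 1))) (respStep (d := 3) 1 (Lc ^ (k + 1))) (respStep (d := 3) 1 (Lc ^ (k + 1)))
            (wilsonA 3) κ₁ u' x' z' (Sum.inl α) (Sum.inl β)|
          ≤ K * ((Lc : ℝ) ^ (12 * (k + 1)))⁻¹ * Real.exp (-(κ' * (supNorm (x' - u') + supNorm (z' - u')))) := by
  obtain ⟨κ₀, C, KE, Φ₀, hκ, hC, -, hΦ, hN1, -, hΦenv, ht⟩ := exists_common_letters (Lc := Lc) hLc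
  set Z : ℝ := Zl (3 + 1) (κ₀ / (4 * (((3 : ℕ) : ℝ) + 1))) with hZ
  have hZ0 : 0 ≤ Z := Zl_nonneg (by positivity)
  -- the root-free face letter
  set F : ℝ := ∑ r' ∈ box (3 + 1) Lc, faceWtSum r' Lc with hF
  have hF0 : 0 ≤ F := Finset.sum_nonneg fun r' _ => faceWtSum_nonneg r' Lc
  set A : ℝ := (8 * (Lc : ℝ) + F * (1 + 8 * (Lc : ℝ) * (Real.exp κ₀ + 1))) * C with hA
  have hA0 : 0 ≤ A := by positivity
  set K3 : ℝ := 8 * A * C * Φ₀ * Real.exp κ₀ * Real.exp κ₀ with hK3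
  set KP : ℝ := 16 * Real.exp (5 * κ₀) * A ^ 2 * Φ₀ * (2 * Real.exp κ₀ + 1) with hKP
  have hK30 : 0 ≤ K3 := by positivity
  have hKP0 : 0 ≤ KP := by positivity
  refine ⟨κ₀ / 24, (3 * K3 + 3 * KP) * Z, by positivity, by positivity, fun r hr rr hrr k κ₁ u' x' z' α β => ?_⟩
  have hFr : faceWtSum r Lc ≤ F := Finset.single_le_sum (fun r' _ => faceWtSum_nonneg r' Lc) hr
  -- the three cells
  rw [← respStep_pow_zero (Lc := Lc) k, contact_combLegChain_ff_eq_cells hr hrr 0 k κ₁ u' x' z' α β]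
  have hL := abs_cellL_bound hLc hr hrr hFr hκ hC hΦ hN1 hΦenv ht k κ₁ u' x' z' α β
  have hR := abs_cellR_bound hLc hr hrr hFr hκ hC hΦ hN1 hΦenv ht k κ₁ u' x' z' α β
  have hW := abs_cellW_bound hLc hr hrr hFr hκ hC hΦ hN1 ht k κ₁ u' x' z' α β
  -- the two power identities
  have c3 := coeff_env3_eq (Lc := Lc) C Φ₀ κ₀ F k
  have cp := coeff_pair_eq (Lc := Lc) C Φ₀ κ₀ F k
  -- names for the recurring blocks (abstracted simultaneously in `hL hR hW c3 cp` and the goal)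
  set X : ℝ := ((Lc : ℝ) ^ (12 * (k + 1)))⁻¹ with hX
  set E' : ℝ := Real.exp (-(κ₀ / 24 * (supNorm (x' - u') + supNorm (z' - u')))) with hE'
  set c₁ : ℝ := (1 / 2 : ℝ) * ((((3 : ℕ) : ℝ) + 1) *
      ((2 * (8 * (Lc : ℝ) * C * ((Lc : ℝ) ^ (5 * (k + 1)))⁻¹ + F * ((1 + 8 * (Lc : ℝ) * (Real.exp κ₀ + 1)) * C * ((Lc : ℝ) ^ (5 * (k + 1)))⁻¹)) *
          (Lc : ℝ) ^ (k + 1)) * Real.exp κ₀) *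
      ((C * ((Lc : ℝ) ^ (5 * (k + 1)))⁻¹) * ((Lc ^ (k + 1) : ℕ) * (Φ₀ * ((Lc : ℝ) ^ (8 * (k + 1)))⁻¹) * Real.exp κ₀)
        + (C * ((Lc : ℝ) ^ (5 * (k + 1)))⁻¹) * ((Lc ^ (k + 1) : ℕ) * (Φ₀ * ((Lc : ℝ) ^ (8 * (k + 1)))⁻¹) * Real.exp κ₀))) with hc₁
  set P : ℝ := 8 * Real.exp (5 * κ₀) *
      (8 * (Lc : ℝ) * C * ((Lc : ℝ) ^ (5 * (k + 1)))⁻¹ + F * ((1 + 8 * (Lc : ℝ) * (Real.exp κ₀ + 1)) * C * ((Lc : ℝ) ^ (5 * (k + 1)))⁻¹)) *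
      (8 * (Lc : ℝ) * C * ((Lc : ℝ) ^ (5 * (k + 1)))⁻¹ + F * ((1 + 8 * (Lc : ℝ) * (Real.exp κ₀ + 1)) * C * ((Lc : ℝ) ^ (5 * (k + 1)))⁻¹)) *
      (Lc : ℝ) ^ (k + 1) * (2 * ((Lc ^ (k + 1) : ℕ) * (Φ₀ * ((Lc : ℝ) ^ (8 * (k + 1)))⁻¹) * Real.exp κ₀)
        + (Φ₀ * ((Lc : ℝ) ^ (8 * (k + 1)))⁻¹) * (Lc : ℝ) ^ (k + 1)) with hP
  set N4 : ℝ := (((Lc ^ (k + 1) : ℕ) : ℝ)) ^ (3 + 1) with hN4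
  set E₁ : ℝ := Real.exp (-(κ₀ / 12) * (supNorm (u' - x') + supNorm (z' - x'))) with hE₁
  set E₂ : ℝ := Real.exp (-(κ₀ / 12) * (supNorm (x' - z') + supNorm (u' - z'))) with hE₂
  set E₃ : ℝ := Real.exp (-(κ₀ / 12) * (supNorm (x' - u') + supNorm (z' - u'))) with hE₃
  set E₄ : ℝ := Real.exp (-(κ₀ / 12) * (supNorm (u' - z') + supNorm (x' - z'))) with hE₄
  set E₅ : ℝ := Real.exp (-(κ₀ / 12) * (supNorm (z' - x') + supNorm (u' - x'))) with hE₅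
  have hX0 : 0 ≤ X := by positivity
  -- the five exponentials against the target one
  have hmul : ∀ s : ℝ, -(κ₀ / 24) * s = -(κ₀ / 24 * s) := fun s => by ring
  have ex1 : E₁ ≤ E' := by rw [hE', hE₁, ← hmul]; exact exp_spread_rebase hκ.le x' u' z'
  have ex2 : E₂ ≤ E' := by
    rw [hE', hE₂, ← hmul, add_comm (supNorm (x' - z')), add_comm (supNorm (x' - u'))]; exact exp_spread_rebase hκ.le z' u' x'
  have ex3 : E₃ ≤ E' := by rw [hE', hE₃, ← hmul]; exact exp_spread_half hκ.le x' u' z'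
  have ex4 : E₄ ≤ E' := by rw [hE', hE₄, ← hmul, add_comm (supNorm (x' - u'))]; exact exp_spread_rebase hκ.le z' u' x'
  have ex5 : E₅ ≤ E' := by rw [hE', hE₅, ← hmul, add_comm (supNorm (z' - x'))]; exact exp_spread_rebase hκ.le x' u' z'
  -- each piece against `K·X·Z·E'`
  have hK3XZ : 0 ≤ K3 * X * Z := mul_nonneg (mul_nonneg hK30 hX0) hZ0
  have hKPXZ : 0 ≤ KP * X * Z := mul_nonneg (mul_nonneg hKP0 hX0) hZ0
  have t3 : ∀ {E : ℝ}, E ≤ E' → c₁ * (N4 * Z * E) ≤ K3 * X * Z * E' := by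
    intro E hEE
    calc c₁ * (N4 * Z * E) = (K3 * X) * Z * E := by rw [← c3]; ring
      _ ≤ (K3 * X) * Z * E' := mul_le_mul_of_nonneg_left hEE hK3XZ
  have tP : ∀ {E : ℝ}, E ≤ E' → (1 / 2 : ℝ) * ((((3 : ℕ) : ℝ) + 1) * (P * (N4 * Z * E))) ≤ KP * X * Z * E' := by
    intro E hEE
    calc (1 / 2 : ℝ) * ((((3 : ℕ) : ℝ) + 1) * (P * (N4 * Z * E))) = (KP * X) * Z * E := by rw [← cp]; ring
      _ ≤ (KP * X) * Z * E' := mul_le_mul_of_nonneg_left hEE hKPXZ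
  have bL := hL.trans (add_le_add (add_le_add (t3 ex1) (tP ex2)) (tP ex3))
  have bR := hR.trans (add_le_add (t3 ex4) (tP ex5))
  have bW := hW.trans (t3 ex3)
  -- sum
  have habs := (abs_add_le _ _).trans (add_le_add (abs_sub _ _) bW) |>.trans (add_le_add (add_le_add bL bR) le_rfl)
  refine habs.trans (le_of_eq ?_)
  ring

/-! ## §3 The centred roots: LITERALLY M.104's hypothesis `hCT` -/

/-- NOT IN PRINT; OUR PROOF.  **THE (III′) WILSON CONTACT END AT THE CENTRED ROOTS `r = rr = ctrOff 4 Lc`** — §2 at the centre (`ctr 4 Lc = toSite (ctrOff 4 Lc)`, `ctrOff_mem_box`):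
EXACTLY the hypothesis `hCT` of road-P2's M.104 `CombSRowsOfContactLetters.exists_hS_hSall_ScombOf_of_contactLetters` (and of M.52 ∕ M.54's Wilson sector rows), from `2 ≤ Lc` ALONE —
the first of the six (b)-letters of the END `CombChargeRowsClosed` DISCHARGED. -/
theorem exists_comb_contact_bound_ctr (hLc : 2 ≤ Lc) :
    ∃ κ' K : ℝ, 0 < κ' ∧ 0 ≤ K ∧
      ∀ (k : ℕ) (κ₁ : Fin (3 + 1)) (u' x' z' : Site (3 + 1)) (α β : Fin (3 + 1)),
        |push₃
            (legChain (fun j => legComp (fun α x κ u => psiKS (ctrOff (3 + 1) Lc) Lc u x (Sum.inl κ) (Sum.inl α)) (respStepBmSeq (d := 3) (ctr (3 + 1) Lc) Lc j)) 0 k)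
            (legChain (fun j => legComp (fun α x κ u => psiKS (ctrOff (3 + 1) Lc) Lc u x (Sum.inl κ) (Sum.inl α)) (respStepBmSeq (d := 3) (ctr (3 + 1) Lc) Lc j)) 0 k)
            (legChain (fun j => legComp (fun α x κ u => psiKS (ctrOff (3 + 1) Lc) Lc u x (Sum.inl κ) (Sum.inl α)) (respStepBmSeq (d := 3) (ctr (3 + 1) Lc) Lc j)) 0 k)
            (wilsonA 3) κ₁ u' x' z' (Sum.inl α) (Sum.inl β)
          - push₃ (respStep (d := 3) 1 (Lc ^ (k + 1))) (respStep (d := 3) 1 (Lc ^ (k + 1))) (respStep (d := 3) 1 (Lc ^ (k + 1)))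
                (wilsonA 3) κ₁ u' x' z' (Sum.inl α) (Sum.inl β)|
          ≤ K * ((Lc : ℝ) ^ (12 * (k + 1)))⁻¹ * Real.exp (-(κ' * (supNorm (x' - u') + supNorm (z' - u')))) := by
  obtain ⟨κ', K, hκ', hK, h⟩ := exists_comb_contact_bound (Lc := Lc) hLc
  have hc : ctrOff (3 + 1) Lc ∈ box (3 + 1) Lc := ctrOff_mem_box (by omega)
  exact ⟨κ', K, hκ', hK, fun k κ₁ u' x' z' α β => h _ hc _ hc k κ₁ u' x' z' α β⟩

end Summit.QuantumFields.BalabanUV.Beta.GAN24.CombContactAssembly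

end
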